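import Summits.QuantumFields.BalabanUV.Beta.FP.SliceExchangeJets

/-!
# The one-shot-sliced composite step law FROM 2-JETS ONLY — analysis-free (road «FP», route T row (T-INST-j) for a jets-only literal)

Owner file of road «FP» (unit `b2b-balaban-beta-d1-p3`, gen 17).  `NestedStepLawOneShot.secondVar_oneShot_nestedStepLaw` (p307295) is the integration theorem in
CURVE form; the literal's torus objects of record are 2-JETS (zero-background tables + insertion families).  This file is the same theorem with NO curve, NO
derivative and NO filter in the statement: `SliceExchangeJets.secondVar_kkt_slice_change_jets_of_range` (one-shot STATIC comb slice `P` ↦ MOVING nested comb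
slice `[τ₂Q₁; τ₁]`, Ward letters ORDER BY ORDER) ∘ `NestedStepLawOneShot.secondVar_kkt_fromRows_assoc` ∘ `NestedStepLawJetsCorner.secondVar_nestedStepLaw_corner`.

**`secondVar_oneShot_nestedStepLaw_jets`.**  DATA: twelve matrices — fine form jets `H₀,H₁,H₂`, one-step averaging jets `Q₁₀,Q₁₁,Q₁₂`, coarse averaging jets
`Q₂₀,Q₂₁,Q₂₂`, block-term jets `G₀,G₁,G₂` — two STATIC comb slices `τ₁` (fine), `τ₂` (block), the STATIC one-shot comb slice `P` (rows `ρ₂ ⊕ ρ₁`), generator jets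
`W₀,W₁,W₂`, multiplier letter jets `Y₀,Y₁,Y₂,Y'₀,Y'₁,Y'₂`; the COMPOSITE jets NAMED (`𝔎ᵢ`, `𝔔ᵢ` with their defining equations as hypotheses — product rule); the
blocks `Γ, 𝓘, 𝓘ᴸ, 𝔊` of the inverse of the fine sliced system and `B = [Q₁₁;0]` NAMED.  HYPOTHESES: the Ward letters of the COMPOSITE system to second order at `0`
(`𝔎₀W₀ = 𝔔₀ᵀY₀`, `𝔎₁W₀ + 𝔎₀W₁ = 𝔔₁ᵀY₀ + 𝔔₀ᵀY₁`, `𝔎₂W₀ + 2𝔎₁W₁ + 𝔎₀W₂ = 𝔔₂ᵀY₀ + 2𝔔₁ᵀY₁ + 𝔔₀ᵀY₂`, the same for `𝔎ᵀ` with `Y'`; `𝔔₀W₀ = 0`,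
`𝔔₁W₀ + 𝔔₀W₁ = 0`, `𝔔₂W₀ + 2𝔔₁W₁ + 𝔔₀W₂ = 0`); the two Faddeev–Popov operators `P·W₀`, `[τ₂Q₁₀;τ₁]·W₀` non-degenerate; (INV) `det kkt H₀ [Q₁₀;τ₁] ≠ 0`,
`det kkt (𝔊₁₁ + G₀) [Q₂₀;τ₂] ≠ 0`.  CONCLUSION: `secondVar (kkt 𝔎₀ [𝔔₀;P]) (kkt 𝔎₁ [𝔔₁;0]) (kkt 𝔎₂ [𝔔₂;0])` (the ONE-SHOT-sliced composite 2-jet — static slice rows)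
`=` fine one-step sliced `+` COARSE SLICED (transported jets of `secondVar_nestedStepLaw_corner`) `+ 2·secondVar (PW₀)(PW₁)(PW₂) − 2·secondVar` (the 2-jet of
`[τ₂Q₁;τ₁]·W`).  Under the jet-level unimodularity letters (both Faddeev–Popov second variations `= 0`) the last two terms vanish: **`secondVar_oneShot_nestedStepLaw_jets_of_uni`**.
WHAT THE (T-ID) HOLDERS SUPPLY against this file: matrices and finitely many matrix identities — no family, no regularity.
HONEST: model-level finite-dimensional algebra (the analysis is inside the lemmas used); nothing here is the road's (SDF), (D1), BetaPertH, a continuum statement or Clay.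
HONEST DEPENDENCY: continuum YM on T⁴ ⇐ BetaPertH ∧ nine spine estimates (0/9 proved); BetaPertH ⇐ (D1) ∧ (D4) ∧ CAP+tail; G-an2-4 gates asym, D1 and NE2/3/4.
-/

noncomputable section

namespace Summit.QuantumFields.BalabanUV.Beta.FP.NestedStepLawOneShotJets

open Matrix Finset
open Literature.MathematicalPhysics.QuantumFieldTheory.Balaban1983to89.Beta.Composition (kkt)
open Literature.MathematicalPhysics.QuantumFieldTheory.Balaban1983to89.Beta.CompositionSingular (effForm flucCov minOp minOpL)
open Literature.MathematicalPhysics.QuantumFieldTheory.Balaban1983to89.Beta.SliceComposition (det_kkt_reindex fromRows_assoc)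
open Summit.QuantumFields.BalabanUV.Beta.D1BFx.LogDetSecondVariation (secondVar)
open Summit.QuantumFields.BalabanUV.Beta.FP.NestedStepLawJetsCorner (secondVar_nestedStepLaw_corner)
open Summit.QuantumFields.BalabanUV.Beta.FP.NestedStepLawOneShot (secondVar_kkt_fromRows_assoc det_kkt_compSliced_ne_zero)
open Summit.QuantumFields.BalabanUV.Beta.FP.SliceExchangeJets (secondVar_kkt_slice_change_jets_of_range)

variable {ν μ κ ρ₁ ρ₂ : Type*} [Fintype ν] [Fintype μ] [Fintype κ] [Fintype ρ₁] [Fintype ρ₂]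
  [DecidableEq ν] [DecidableEq μ] [DecidableEq κ] [DecidableEq ρ₁] [DecidableEq ρ₂]

/-- [folklore] **THE ONE-SHOT-SLICED COMPOSITE STEP LAW FROM 2-JETS** (see the module docstring for the reading of every letter).  The composite jets `𝔎ᵢ`, `𝔔ᵢ` are
NAMED with their product-rule equations as hypotheses; the Faddeev–Popov jet terms are DISPLAYED. -/
theorem secondVar_oneShot_nestedStepLaw_jets
    (H₀ H₁ H₂ : Matrix ν ν ℝ) (Q₁₀ Q₁₁ Q₁₂ : Matrix μ ν ℝ) (Q₂₀ Q₂₁ Q₂₂ : Matrix κ μ ℝ) (G₀ G₁ G₂ : Matrix μ μ ℝ)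
    (τ₁ : Matrix ρ₁ ν ℝ) (τ₂ : Matrix ρ₂ μ ℝ) (P : Matrix (ρ₂ ⊕ ρ₁) ν ℝ) (W₀ W₁ W₂ : Matrix ν (ρ₂ ⊕ ρ₁) ℝ) (Y₀ Y₁ Y₂ Y'₀ Y'₁ Y'₂ : Matrix κ (ρ₂ ⊕ ρ₁) ℝ)
    -- the composite jets, NAMED
    {𝔎₀ 𝔎₁ 𝔎₂ : Matrix ν ν ℝ} {𝔔₀ 𝔔₁ 𝔔₂ : Matrix κ ν ℝ}
    (h𝔎₀ : H₀ + Q₁₀ᵀ * G₀ * Q₁₀ = 𝔎₀) (h𝔎₁ : H₁ + (Q₁₁ᵀ * G₀ * Q₁₀ + Q₁₀ᵀ * G₁ * Q₁₀ + Q₁₀ᵀ * G₀ * Q₁₁) = 𝔎₁)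
    (h𝔎₂ : H₂ + ((Q₁₂ᵀ * G₀ * Q₁₀ + Q₁₁ᵀ * G₁ * Q₁₀ + Q₁₁ᵀ * G₀ * Q₁₁) + (Q₁₁ᵀ * G₁ * Q₁₀ + Q₁₀ᵀ * G₂ * Q₁₀ + Q₁₀ᵀ * G₁ * Q₁₁)
            + (Q₁₁ᵀ * G₀ * Q₁₁ + Q₁₀ᵀ * G₁ * Q₁₁ + Q₁₀ᵀ * G₀ * Q₁₂)) = 𝔎₂)
    (h𝔔₀ : Q₂₀ * Q₁₀ = 𝔔₀) (h𝔔₁ : Q₂₁ * Q₁₀ + Q₂₀ * Q₁₁ = 𝔔₁) (h𝔔₂ : Q₂₂ * Q₁₀ + Q₂₁ * Q₁₁ + (Q₂₁ * Q₁₁ + Q₂₀ * Q₁₂) = 𝔔₂)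
    -- Ward letters of the composite system to second order at `0` (gauge invariance of `𝔎` on `ker 𝔔`; `𝔔` kills the generators)
    (a0 : 𝔎₀ * W₀ = 𝔔₀ᵀ * Y₀) (a1 : 𝔎₁ * W₀ + 𝔎₀ * W₁ = 𝔔₁ᵀ * Y₀ + 𝔔₀ᵀ * Y₁)
    (a2 : 𝔎₂ * W₀ + (2 : ℝ) • (𝔎₁ * W₁) + 𝔎₀ * W₂ = 𝔔₂ᵀ * Y₀ + (2 : ℝ) • (𝔔₁ᵀ * Y₁) + 𝔔₀ᵀ * Y₂)
    (a0t : 𝔎₀ᵀ * W₀ = 𝔔₀ᵀ * Y'₀) (a1t : 𝔎₁ᵀ * W₀ + 𝔎₀ᵀ * W₁ = 𝔔₁ᵀ * Y'₀ + 𝔔₀ᵀ * Y'₁)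
    (a2t : 𝔎₂ᵀ * W₀ + (2 : ℝ) • (𝔎₁ᵀ * W₁) + 𝔎₀ᵀ * W₂ = 𝔔₂ᵀ * Y'₀ + (2 : ℝ) • (𝔔₁ᵀ * Y'₁) + 𝔔₀ᵀ * Y'₂)
    (b0 : 𝔔₀ * W₀ = 0) (b1 : 𝔔₁ * W₀ + 𝔔₀ * W₁ = 0) (b2 : 𝔔₂ * W₀ + (2 : ℝ) • (𝔔₁ * W₁) + 𝔔₀ * W₂ = 0)
    -- the two Faddeev–Popov operators are non-degenerate
    (hPW : (P * W₀).det ≠ 0) (hTW : (fromRows (τ₂ * Q₁₀) τ₁ * W₀).det ≠ 0)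
    -- blocks of the inverse of the fine sliced system and the sliced border jet, NAMED
    {Γ : Matrix ν ν ℝ} {I : Matrix ν (μ ⊕ ρ₁) ℝ} {L : Matrix (μ ⊕ ρ₁) ν ℝ} {S : Matrix (μ ⊕ ρ₁) (μ ⊕ ρ₁) ℝ} {B : Matrix (μ ⊕ ρ₁) ν ℝ}
    (hΓ : flucCov H₀ (fromRows Q₁₀ τ₁) = Γ) (hI : minOp H₀ (fromRows Q₁₀ τ₁) = I) (hL : minOpL H₀ (fromRows Q₁₀ τ₁) = L) (hS : effForm H₀ (fromRows Q₁₀ τ₁) = S)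
    (hB : fromRows Q₁₁ (0 : Matrix ρ₁ ν ℝ) = B)
    -- (INV)
    (h1 : (kkt H₀ (fromRows Q₁₀ τ₁)).det ≠ 0)
    (h2 : (kkt (S.toBlocks₁₁ + G₀) (fromRows Q₂₀ τ₂)).det ≠ 0) :
    secondVar (kkt 𝔎₀ (fromRows 𝔔₀ P)) (kkt 𝔎₁ (fromRows 𝔔₁ (0 : Matrix (ρ₂ ⊕ ρ₁) ν ℝ))) (kkt 𝔎₂ (fromRows 𝔔₂ (0 : Matrix (ρ₂ ⊕ ρ₁) ν ℝ)))
      = secondVar (kkt H₀ (fromRows Q₁₀ τ₁)) (kkt H₁ B) (kkt H₂ (fromRows Q₁₂ (0 : Matrix ρ₁ ν ℝ)))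
        + secondVar
            (kkt (S.toBlocks₁₁ + G₀) (fromRows Q₂₀ τ₂))
            (kkt (((L * H₁ - S * B) * I - L * Bᵀ * S).toBlocks₁₁ + G₁) (fromRows Q₂₁ (0 : Matrix ρ₂ μ ℝ)))
            (kkt ((((-((L * H₁ - S * B) * Γ + L * Bᵀ * L) * H₁ + L * H₂
                      - (((L * H₁ - S * B) * I - L * Bᵀ * S) * B + S * fromRows Q₁₂ (0 : Matrix ρ₁ ν ℝ))) * I
                    + (L * H₁ - S * B) * (-((Γ * H₁ + I * B) * I - Γ * Bᵀ * S)))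
                  - ((-((L * H₁ - S * B) * Γ + L * Bᵀ * L) * Bᵀ + L * (fromRows Q₁₂ (0 : Matrix ρ₁ ν ℝ))ᵀ) * S
                      + L * Bᵀ * ((L * H₁ - S * B) * I - L * Bᵀ * S))).toBlocks₁₁ + G₂)
              (fromRows Q₂₂ (0 : Matrix ρ₂ μ ℝ)))
        + (2 * secondVar (P * W₀) (P * W₁) (P * W₂)
          - 2 * secondVar (fromRows (τ₂ * Q₁₀) τ₁ * W₀) (fromRows (τ₂ * Q₁₁) (0 : Matrix ρ₁ ν ℝ) * W₀ + fromRows (τ₂ * Q₁₀) τ₁ * W₁)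
              (fromRows (τ₂ * Q₁₂) (0 : Matrix ρ₁ ν ℝ) * W₀ + fromRows (τ₂ * Q₁₁) (0 : Matrix ρ₁ ν ℝ) * W₁
                + (fromRows (τ₂ * Q₁₁) (0 : Matrix ρ₁ ν ℝ) * W₁ + fromRows (τ₂ * Q₁₀) τ₁ * W₂))) := by
  -- the nested-sliced composite system is non-degenerate at `0` (rows regrouped `[𝔔₀; [τ₂Q₁₀; τ₁]]`)
  have h0 : (kkt 𝔎₀ (fromRows 𝔔₀ (fromRows (τ₂ * Q₁₀) τ₁))).det ≠ 0 := by
    rw [← h𝔎₀, ← h𝔔₀, fromRows_assoc, det_kkt_reindex]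
    exact det_kkt_compSliced_ne_zero H₀ Q₁₀ Q₂₀ G₀ τ₁ τ₂ hS h1 h2
  -- the slice exchange from 2-jets (static one-shot slice `P` ↦ moving nested comb slice), Faddeev–Popov jet terms displayed
  rw [secondVar_kkt_slice_change_jets_of_range 𝔎₀ 𝔎₁ 𝔎₂ 𝔔₀ 𝔔₁ 𝔔₂ (fromRows (τ₂ * Q₁₀) τ₁) (fromRows (τ₂ * Q₁₁) (0 : Matrix ρ₁ ν ℝ))
    (fromRows (τ₂ * Q₁₂) (0 : Matrix ρ₁ ν ℝ)) P W₀ W₁ W₂ Y₀ Y₁ Y₂ Y'₀ Y'₁ Y'₂ a0 a1 a2 a0t a1t a2t b0 b1 b2 hPW hTW h0,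
    ← h𝔎₀, ← h𝔎₁, ← h𝔎₂, ← h𝔔₀, ← h𝔔₁, ← h𝔔₂, secondVar_kkt_fromRows_assoc,
    secondVar_nestedStepLaw_corner H₀ H₁ H₂ Q₁₀ Q₁₁ Q₁₂ Q₂₀ Q₂₁ Q₂₂ G₀ G₁ G₂ τ₁ τ₂ hΓ hI hL hS hB h1 h2]

/-- [folklore] **THE ONE-SHOT-SLICED COMPOSITE STEP LAW FROM 2-JETS UNDER THE JET-LEVEL UNIMODULARITY LETTERS** — `secondVar (PW₀)(PW₁)(PW₂) = 0` and
`secondVar` of the nested comb Faddeev–Popov 2-jet `= 0` (comb ∕ tree slices: `log|det|` of either operator is constant along the genuine family, hence its 2-jet identity holds):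
ZERO STEP DEFECT, ZERO SLICE-EXCHANGE DEFECT — the exact finite-`j` semigroup law's analysis-free shape. -/
theorem secondVar_oneShot_nestedStepLaw_jets_of_uni
    (H₀ H₁ H₂ : Matrix ν ν ℝ) (Q₁₀ Q₁₁ Q₁₂ : Matrix μ ν ℝ) (Q₂₀ Q₂₁ Q₂₂ : Matrix κ μ ℝ) (G₀ G₁ G₂ : Matrix μ μ ℝ)
    (τ₁ : Matrix ρ₁ ν ℝ) (τ₂ : Matrix ρ₂ μ ℝ) (P : Matrix (ρ₂ ⊕ ρ₁) ν ℝ) (W₀ W₁ W₂ : Matrix ν (ρ₂ ⊕ ρ₁) ℝ) (Y₀ Y₁ Y₂ Y'₀ Y'₁ Y'₂ : Matrix κ (ρ₂ ⊕ ρ₁) ℝ)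
    {𝔎₀ 𝔎₁ 𝔎₂ : Matrix ν ν ℝ} {𝔔₀ 𝔔₁ 𝔔₂ : Matrix κ ν ℝ}
    (h𝔎₀ : H₀ + Q₁₀ᵀ * G₀ * Q₁₀ = 𝔎₀) (h𝔎₁ : H₁ + (Q₁₁ᵀ * G₀ * Q₁₀ + Q₁₀ᵀ * G₁ * Q₁₀ + Q₁₀ᵀ * G₀ * Q₁₁) = 𝔎₁)
    (h𝔎₂ : H₂ + ((Q₁₂ᵀ * G₀ * Q₁₀ + Q₁₁ᵀ * G₁ * Q₁₀ + Q₁₁ᵀ * G₀ * Q₁₁) + (Q₁₁ᵀ * G₁ * Q₁₀ + Q₁₀ᵀ * G₂ * Q₁₀ + Q₁₀ᵀ * G₁ * Q₁₁)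
            + (Q₁₁ᵀ * G₀ * Q₁₁ + Q₁₀ᵀ * G₁ * Q₁₁ + Q₁₀ᵀ * G₀ * Q₁₂)) = 𝔎₂)
    (h𝔔₀ : Q₂₀ * Q₁₀ = 𝔔₀) (h𝔔₁ : Q₂₁ * Q₁₀ + Q₂₀ * Q₁₁ = 𝔔₁) (h𝔔₂ : Q₂₂ * Q₁₀ + Q₂₁ * Q₁₁ + (Q₂₁ * Q₁₁ + Q₂₀ * Q₁₂) = 𝔔₂)
    (a0 : 𝔎₀ * W₀ = 𝔔₀ᵀ * Y₀) (a1 : 𝔎₁ * W₀ + 𝔎₀ * W₁ = 𝔔₁ᵀ * Y₀ + 𝔔₀ᵀ * Y₁)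
    (a2 : 𝔎₂ * W₀ + (2 : ℝ) • (𝔎₁ * W₁) + 𝔎₀ * W₂ = 𝔔₂ᵀ * Y₀ + (2 : ℝ) • (𝔔₁ᵀ * Y₁) + 𝔔₀ᵀ * Y₂)
    (a0t : 𝔎₀ᵀ * W₀ = 𝔔₀ᵀ * Y'₀) (a1t : 𝔎₁ᵀ * W₀ + 𝔎₀ᵀ * W₁ = 𝔔₁ᵀ * Y'₀ + 𝔔₀ᵀ * Y'₁)
    (a2t : 𝔎₂ᵀ * W₀ + (2 : ℝ) • (𝔎₁ᵀ * W₁) + 𝔎₀ᵀ * W₂ = 𝔔₂ᵀ * Y'₀ + (2 : ℝ) • (𝔔₁ᵀ * Y'₁) + 𝔔₀ᵀ * Y'₂)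
    (b0 : 𝔔₀ * W₀ = 0) (b1 : 𝔔₁ * W₀ + 𝔔₀ * W₁ = 0) (b2 : 𝔔₂ * W₀ + (2 : ℝ) • (𝔔₁ * W₁) + 𝔔₀ * W₂ = 0)
    (hPW : (P * W₀).det ≠ 0) (hTW : (fromRows (τ₂ * Q₁₀) τ₁ * W₀).det ≠ 0)
    -- (UNI) at jet level: both Faddeev–Popov second variations vanish
    (hUP : secondVar (P * W₀) (P * W₁) (P * W₂) = 0)
    (hUT : secondVar (fromRows (τ₂ * Q₁₀) τ₁ * W₀) (fromRows (τ₂ * Q₁₁) (0 : Matrix ρ₁ ν ℝ) * W₀ + fromRows (τ₂ * Q₁₀) τ₁ * W₁)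
      (fromRows (τ₂ * Q₁₂) (0 : Matrix ρ₁ ν ℝ) * W₀ + fromRows (τ₂ * Q₁₁) (0 : Matrix ρ₁ ν ℝ) * W₁
        + (fromRows (τ₂ * Q₁₁) (0 : Matrix ρ₁ ν ℝ) * W₁ + fromRows (τ₂ * Q₁₀) τ₁ * W₂)) = 0)
    {Γ : Matrix ν ν ℝ} {I : Matrix ν (μ ⊕ ρ₁) ℝ} {L : Matrix (μ ⊕ ρ₁) ν ℝ} {S : Matrix (μ ⊕ ρ₁) (μ ⊕ ρ₁) ℝ} {B : Matrix (μ ⊕ ρ₁) ν ℝ}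
    (hΓ : flucCov H₀ (fromRows Q₁₀ τ₁) = Γ) (hI : minOp H₀ (fromRows Q₁₀ τ₁) = I) (hL : minOpL H₀ (fromRows Q₁₀ τ₁) = L) (hS : effForm H₀ (fromRows Q₁₀ τ₁) = S)
    (hB : fromRows Q₁₁ (0 : Matrix ρ₁ ν ℝ) = B)
    (h1 : (kkt H₀ (fromRows Q₁₀ τ₁)).det ≠ 0)
    (h2 : (kkt (S.toBlocks₁₁ + G₀) (fromRows Q₂₀ τ₂)).det ≠ 0) :
    secondVar (kkt 𝔎₀ (fromRows 𝔔₀ P)) (kkt 𝔎₁ (fromRows 𝔔₁ (0 : Matrix (ρ₂ ⊕ ρ₁) ν ℝ))) (kkt 𝔎₂ (fromRows 𝔔₂ (0 : Matrix (ρ₂ ⊕ ρ₁) ν ℝ)))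
      = secondVar (kkt H₀ (fromRows Q₁₀ τ₁)) (kkt H₁ B) (kkt H₂ (fromRows Q₁₂ (0 : Matrix ρ₁ ν ℝ)))
        + secondVar
            (kkt (S.toBlocks₁₁ + G₀) (fromRows Q₂₀ τ₂))
            (kkt (((L * H₁ - S * B) * I - L * Bᵀ * S).toBlocks₁₁ + G₁) (fromRows Q₂₁ (0 : Matrix ρ₂ μ ℝ)))
            (kkt ((((-((L * H₁ - S * B) * Γ + L * Bᵀ * L) * H₁ + L * H₂
                      - (((L * H₁ - S * B) * I - L * Bᵀ * S) * B + S * fromRows Q₁₂ (0 : Matrix ρ₁ ν ℝ))) * I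
                    + (L * H₁ - S * B) * (-((Γ * H₁ + I * B) * I - Γ * Bᵀ * S)))
                  - ((-((L * H₁ - S * B) * Γ + L * Bᵀ * L) * Bᵀ + L * (fromRows Q₁₂ (0 : Matrix ρ₁ ν ℝ))ᵀ) * S
                      + L * Bᵀ * ((L * H₁ - S * B) * I - L * Bᵀ * S))).toBlocks₁₁ + G₂)
              (fromRows Q₂₂ (0 : Matrix ρ₂ μ ℝ))) := by
  rw [secondVar_oneShot_nestedStepLaw_jets H₀ H₁ H₂ Q₁₀ Q₁₁ Q₁₂ Q₂₀ Q₂₁ Q₂₂ G₀ G₁ G₂ τ₁ τ₂ P W₀ W₁ W₂ Y₀ Y₁ Y₂ Y'₀ Y'₁ Y'₂ h𝔎₀ h𝔎₁ h𝔎₂ h𝔔₀ h𝔔₁ h𝔔₂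
    a0 a1 a2 a0t a1t a2t b0 b1 b2 hPW hTW hΓ hI hL hS hB h1 h2, hUP, hUT]
  ring

end Summit.QuantumFields.BalabanUV.Beta.FP.NestedStepLawOneShotJets

end
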